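import Summits.HodgeConjecture.HodgeConjecture.Theses.GenericDivisibility
import Summits.HodgeConjecture.HodgeConjecture.Theorems.GenericDivisibilityHodgeClassesGenericallyDivisibleBirationalInvariance
import Summits.HodgeConjecture.HodgeConjecture.Theorems.GenericDivisibilityHodgeClassesGenericallyDivisibleStubBockstein
import Summits.HodgeConjecture.HodgeConjecture.Theorems.GenericDivisibilityHodgeClassesGenericallyDivisibleProjectiveSpace
import Literature.AlgebraicTopology.SingularHomology.GysinMapDegreeOneIsoLocus
import Literature.AlgebraicGeometry.HodgeTheory.AlgebraicClassesCup
import Literature.AlgebraicGeometry.Motives.CorrespondencesKunneth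
import HarnessLib

/-!
# Route GenericDivisibility — crux C1 `HodgeClassesGenericallyDivisible` (stmt-HodgeConjecture-18466)
# is an UNCONDITIONAL birational invariant of smooth projective `2p`-folds

`σ : X' ⟶ X` is a `ℂ`-morphism of smooth projective `2p`-folds with `σ.left` birational (an
isomorphism over a dense open `U ⊆ X`), `f = σ(ℂ)`, `H = H²ᵖ(–(ℂ); ℤ)`, `z| = z|_{(X∖Z)(ℂ)}`.
"C1 at `X`": every `z ∈ H²ᵖ(X(ℂ);ℤ)` with `z ⊗ ℂ` of type `(p,p)` is, for every `m ≥ 1`, an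
`m`-multiple on the complex points of some non-empty Zariski open.

`…BirationalDescent` proved C1 at `X'` ⟹ C1 at `X`; `…BirationalInvariance` proved the converse
GRANTED the route's `TorsionDiesGenerically` (Bloch–Kato), the one place where the integral class
`κ = z' - σ^* σ_! z'` — which dies on `(σ⁻¹U)(ℂ)` by proper base change in Borel–Moore homology — could
only be shown generically TORSION. This file removes the hypothesis: **C1 at `X` ⟹ C1 at `X'`
unconditionally**, so C1 is a birational invariant of smooth projective `2p`-folds exactly like the
Hodge conjecture and like the companion crux C2.

## The argument

With `G = σ_!` the integral Gysin map for the complex orientations (degree one,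
`hasDegree_one_complexOrientationInt_of_isBirational`), `z = G z'` (Hodge, of type `(p,p)`:
`isOfHodgeType_ringChange_gysinMap_complexOrientationInt`) and `κ = z' - σ^* z`:
* `κ` vanishes near every compact subset of `(σ⁻¹U)(ℂ)` INTEGRALLY — `G κ = 0`, so
  `σ_*(κ ⌢ [X']) = 0`, so `j_*(κ ⌢ [X']) = 0 ∈ H_q(X'(ℂ), X'(ℂ) ∖ C)` through the excision
  isomorphism onto `H_q(X(ℂ), X(ℂ) ∖ σC)` (`σ(ℂ)` is a homeomorphism `(σ⁻¹U)(ℂ) ≃ U(ℂ)`,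
  `genericDivisibilityBounded_exists_homeomorph_compl`), and Čech–Poincaré duality along `C` — hence
  **`κ ≡ 0 (mod m)` on all of `(σ⁻¹U)(ℂ)` for every `m ≥ 1`**: over the self-injective ring `ℤ/m`
  cohomology classes of the open manifold `(σ⁻¹U)(ℂ)` are detected by homology classes, which have
  compact carriers (the tree's `ringChange_map_sub_map_gysinMap_eq_zero`,
  `Literature/AlgebraicTopology/SingularHomology/GysinMapDegreeOneIsoLocus`, with
  `KroneckerInjectiveSelfInjective`);
* Bockstein: `κ| = m • y₂` on `(σ⁻¹U)(ℂ)` (`stub_bockstein`);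
* C1 at `X` for the Hodge class `z`, pulled back along the surjection `σ`: `(σ^* z)| = m • y₁` off
  `σ⁻¹Z₁`; and `z' = σ^* z + κ` on the intersection `(X' ∖ (σ⁻¹Z₁ ∪ σ⁻¹(X ∖ U)))(ℂ)`.

## Main results

* `hodgeClassesGenericallyDivisible_at_of_isBirational_up` — **C1 at `X` ⟹ C1 at `X'`**,
  unconditionally;
* `hodgeClassesGenericallyDivisible_iff_of_isBirational` — **C1 at `X'` ⟺ C1 at `X`**;
* `hodgeClassesGenericallyDivisible_at_of_roof` — C1 passes across a roof `X ← X'' → Y` of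
  birational morphisms of smooth projective `2p`-folds;
* `hodgeClassesGenericallyDivisible_at_of_roof_tensorProjectiveSpace` — **C1 holds, for every
  Hodge class, on every smooth projective `2p`-fold dominated birationally (through such a roof) by
  a product `W ⊗ ℙⁿ`, `n ≥ 1`** (the Hodge-blind sector `stub_hodgeClassesGenericallyDivisible_tensorProjectiveSpace`
  transported along the birational invariance): birationally ruled `2p`-folds given with a roof.
* `stub_hodgeClassesGenericallyDivisible_of_isBirational_up_unconditional` — the registered
  sub-goal of stmt-HodgeConjecture-18466, closed form.

References: [VoisinHodgeI2002] §7.3.2 Lemma 7.28, proof of Thm. 7.31; [Fulton1998] Lemma 19.1.2,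
§19.1; [FultonYoungTableaux1997] App. B §B.1 (5)–(7), §B.2 Exercise 5; [HatcherAT2002] Thm. 2.20,
§3.1 Thm. 3.2, §3.3 Thm. 3.30, 3.44, §3.E; [Lam1999] §15; [SGA1] XII Prop. 3.1 (xi).
-/

set_option linter.dupNamespace false

noncomputable section

namespace Summit.HodgeConjecture.HodgeConjecture.Theorems

open CategoryTheory AlgebraicGeometry
open Literature.AlgebraicGeometry.Motives Literature.AlgebraicGeometry.HodgeTheory
  Literature.AlgebraicTopology.SingularHomology

/-- Restriction `H^k(X(ℂ);ℤ) → H^k((X∖Z)(ℂ);ℤ)`, the very term of the route decls (notation only). -/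
local notation3 (prettyPrint := false) "Res[" X ", " Z ", " k "]" =>
  singularCohomology.map ℤ ℤ
    (⟨Subtype.val, continuous_subtype_val⟩ : C(complexPointsCompl X Z, ComplexPoints X)) k

/-- The inclusion `(X ∖ Z')(ℂ) ↪ (X ∖ Z)(ℂ)` for `h : Z ⊆ Z'`, spelled as in
`genericDivisibility_restrict_restrict` (notation only). -/
local notation3 (prettyPrint := false) "Incl[" X ", " Z ", " Z' ", " h "]" =>
  (⟨fun P : complexPointsCompl X Z' => (⟨P.1, fun hP : P.1.pt ∈ Z => P.2 (h hP)⟩ :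
      complexPointsCompl X Z),
    continuous_subtype_val.subtype_mk fun (P : complexPointsCompl X Z') (hP : P.1.pt ∈ Z) =>
      P.2 (h hP)⟩ : C(complexPointsCompl X Z', complexPointsCompl X Z))

/-- "C1 at `X`" (dimension `2p`), the crux shape at one variety (notation only). -/
local notation3 (prettyPrint := false) "C1At[" p ", " X "]" =>
  ∀ z : singularCohomology ℤ ℤ (ComplexPoints X) (2 * p),
    IsOfHodgeType (2 * p) X (2 * p) p p
        (singularCohomology.ringChange (Int.castRingHom ℂ) (ComplexPoints X) (2 * p) z) →
      ∀ m : ℕ, 1 ≤ m → ∃ Z : Set (X).left, IsClosed Z ∧ Z ≠ Set.univ ∧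
        ∃ y : singularCohomology ℤ ℤ (complexPointsCompl X Z) (2 * p), m • y = Res[X, Z, 2 * p] z

variable {p : ℕ} {X' X : SchemeOver ℂ}

/-! ### `κ = z' - σ^* σ_! z'` is divisible by every `m` on `(σ⁻¹U)(ℂ)` -/

/-- **The defect of `σ^* σ_!` is divisible by every `m` over the iso locus.** For `σ : X' ⟶ X` a
morphism of smooth projective `n`-folds which is an isomorphism over the open `U ⊆ X`, with
`σ.left` birational, `k + q = 2n`, `z' ∈ H^k(X'(ℂ);ℤ)` and `m ≥ 1`: the class
`κ = z' - σ^*(σ_! z')` (integral Gysin map for the complex orientations) satisfies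
`κ|_{(X' ∖ σ⁻¹(X∖U))(ℂ)} = m • y` for some integral `y`. Indeed `κ` vanishes near every compact subset
of `(σ⁻¹U)(ℂ)` (degree one, excision through the homeomorphism `(σ⁻¹U)(ℂ) ≃ U(ℂ)`, Čech–Poincaré
duality), hence vanishes there modulo `m` (Kronecker detection over the self-injective `ℤ/m`:
`ringChange_map_sub_map_gysinMap_eq_zero`), and Bockstein (`stub_bockstein`).
[cite: FultonYoungTableaux1997, Appendix B §B.2 Exercise 5 with (26), (30)] [cite: Fulton1998, Lemma 19.1.2]
[cite: HatcherAT2002, §3.1 Thm. 3.2, §3.3 Thm. 3.44 and §3.E p. 303] -/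
theorem genericDivisibility_exists_nsmul_eq_restrict_sub_map_gysinMap {n : ℕ}
    (hX' : IsSmoothProjective n X') (hX : IsSmoothProjective n X) (σ : X' ⟶ X)
    (hσ : Literature.AlgebraicGeometry.Resolution.IsBirational σ.left) (U : X.left.Opens)
    [IsIso (σ.left ∣_ U)] {k q : ℕ} (h : k + q = 2 * n)
    (z' : singularCohomology ℤ ℤ (ComplexPoints X') k) {m : ℕ} (hm : 1 ≤ m) :
    letI := hX.chartedSpace
    letI := hX'.chartedSpace
    ∃ y : singularCohomology ℤ ℤ (complexPointsCompl X' (σ.left.base ⁻¹' (U : Set X.left)ᶜ)) k,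
      Res[X', σ.left.base ⁻¹' (U : Set X.left)ᶜ, k]
          (z' - singularCohomology.map ℤ ℤ (AlgPoints.mapContinuous (L := ℂ) σ) k
            (gysinMap (complexOrientationInt hX') (complexOrientationInt hX)
              (AlgPoints.mapContinuous (L := ℂ) σ) h h z')) = m • y := by
  letI := hX.chartedSpace
  letI := hX'.chartedSpace
  haveI := ComplexPoints.compactSpace_of_isSmoothProjective hX
  haveI := ComplexPoints.compactSpace_of_isSmoothProjective hX'
  haveI := ComplexPoints.t2Space_of_isSmoothProjective hX
  haveI := ComplexPoints.t2Space_of_isSmoothProjective hX'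
  haveI : NeZero m := ⟨by omega⟩
  haveI : IsProper σ.left := isProper_left_of_isSmoothProjective hX' hX σ
  set f : C(ComplexPoints X', ComplexPoints X) := AlgPoints.mapContinuous (L := ℂ) σ with hf
  -- the homeomorphism over the iso locus, `(σ⁻¹U)(ℂ) ≃ₜ U(ℂ)`, in the form of the topological theorem
  obtain ⟨e₀, he₀⟩ := genericDivisibilityBounded_exists_homeomorph_compl hX' hX σ U
    (T := (U : Set X.left)ᶜ) subset_rfl
  let U₀ : Set (ComplexPoints X) := {P | P.pt ∉ (U : Set X.left)ᶜ}
  have hU₀ : IsOpen U₀ := isOpen_setOf_pt_not_mem U.2.isClosed_compl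
  let e : ↥(f ⁻¹' U₀) ≃ₜ ↥U₀ := e₀
  have he : ∀ y : ↥(f ⁻¹' U₀), ((e y : ↥U₀) : ComplexPoints X) = f y := fun y ↦
    congrArg (fun g : C(complexPointsCompl X' (σ.left.base ⁻¹' (U : Set X.left)ᶜ),
      complexPointsCompl X (U : Set X.left)ᶜ) ↦ ((g y : ↥U₀) : ComplexPoints X)) he₀
  -- `κ ≡ 0 (mod m)` on `(σ⁻¹U)(ℂ)`
  have hκm := ringChange_map_sub_map_gysinMap_eq_zero (complexOrientationInt hX')
    (complexOrientationInt hX) f (hasDegree_one_complexOrientationInt_of_isBirational hX' hX σ hσ)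
    hU₀ e he h z' m
  rw [← singularCohomology.ringChange_map] at hκm
  -- Bockstein
  obtain ⟨y, hy⟩ := stub_bockstein k m hm _ hκm
  exact ⟨y, hy⟩

/-! ### C1 ascends along birational morphisms, unconditionally -/

/-- **C1 ascends along birational morphisms of smooth projective `2p`-folds (unconditional).**
Let `σ : X' ⟶ X` be birational between smooth projective `2p`-folds and suppose C1 holds at
`X`. Then C1 holds at `X'`: for `z'` with `z' ⊗ ℂ` of type `(p,p)` and `m ≥ 1`, put
`z = σ_! z'` — of type `(p,p)` (`isOfHodgeType_ringChange_gysinMap_complexOrientationInt`) — and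
`κ = z' - σ^* z`; C1 at `X` gives `z| = m • y` off `Z₁`, so `(σ^* z)| = m • y₁` off `σ⁻¹Z₁`
(`genericDivisibilityBounded_divisible_map`); `κ| = m • y₂` off `σ⁻¹(X ∖ U)`
(`genericDivisibility_exists_nsmul_eq_restrict_sub_map_gysinMap`); and `z' = σ^* z + κ` on the
complement of `σ⁻¹Z₁ ∪ σ⁻¹(X ∖ U)`, a proper closed subset (`σ` onto, `X` irreducible).
[cite: VoisinHodgeI2002, §7.3.2 Lemma 7.28 and proof of Thm. 7.31] [cite: Fulton1998, Lemma 19.1.2]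
[cite: FultonYoungTableaux1997, Appendix B §B.2 Exercise 5] -/
theorem hodgeClassesGenericallyDivisible_at_of_isBirational_up
    (hX' : IsSmoothProjective (2 * p) X') (hX : IsSmoothProjective (2 * p) X) (σ : X' ⟶ X)
    (hσ : Literature.AlgebraicGeometry.Resolution.IsBirational σ.left) (hC : C1At[p, X])
    (z' : singularCohomology ℤ ℤ (ComplexPoints X') (2 * p))
    (hz' : IsOfHodgeType (2 * p) X' (2 * p) p p
      (singularCohomology.ringChange (Int.castRingHom ℂ) (ComplexPoints X') (2 * p) z'))
    {m : ℕ} (hm : 1 ≤ m) :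
    ∃ Z : Set X'.left, IsClosed Z ∧ Z ≠ Set.univ ∧
      ∃ y : singularCohomology ℤ ℤ (complexPointsCompl X' Z) (2 * p), m • y = Res[X', Z, 2 * p] z' := by
  letI := hX.chartedSpace
  letI := hX'.chartedSpace
  haveI := ComplexPoints.compactSpace_of_isSmoothProjective hX
  haveI := ComplexPoints.compactSpace_of_isSmoothProjective hX'
  haveI := ComplexPoints.t2Space_of_isSmoothProjective hX
  haveI := ComplexPoints.t2Space_of_isSmoothProjective hX'
  haveI : IsIntegral X'.left := IsSmoothProjective.isIntegral_holds hX'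
  haveI : IsIntegral X.left := IsSmoothProjective.isIntegral_holds hX
  haveI : IsProper σ.left := isProper_left_of_isSmoothProjective hX' hX σ
  have hsurj : Function.Surjective σ.left.base := surjective_base_of_isBirational σ.left hσ
  have hσ' := hσ
  obtain ⟨U, hUd, -, hiso⟩ := hσ'
  haveI : IsIso (σ.left ∣_ U) := hiso
  have h2 : 2 * p + 2 * p = 2 * (2 * p) := by ring
  -- `z = σ_! z'`, `κ = z' - σ^* z`
  set z : singularCohomology ℤ ℤ (ComplexPoints X) (2 * p) :=
    gysinMap (complexOrientationInt hX') (complexOrientationInt hX)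
      (AlgPoints.mapContinuous (L := ℂ) σ) h2 h2 z' with hz
  set κ : singularCohomology ℤ ℤ (ComplexPoints X') (2 * p) :=
    z' - singularCohomology.map ℤ ℤ (AlgPoints.mapContinuous (L := ℂ) σ) (2 * p) z with hκ
  -- `κ| = m • y₂` off `E = σ⁻¹(X ∖ U)`
  set E : Set X'.left := σ.left.base ⁻¹' (U : Set X.left)ᶜ with hEdef
  have hE : IsClosed E := U.2.isClosed_compl.preimage σ.left.continuous
  have hEne : E ≠ Set.univ := by
    refine genericDivisibilityBounded_preimage_ne_univ σ hsurj fun hu ↦ ?_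
    obtain ⟨x, hx⟩ := hUd.nonempty
    exact (hu ▸ Set.mem_univ x : x ∈ (U : Set X.left)ᶜ) hx
  obtain ⟨y₂, hy₂⟩ :=
    genericDivisibility_exists_nsmul_eq_restrict_sub_map_gysinMap hX' hX σ hσ U h2 z' hm
  -- `z ⊗ ℂ` is of type `(p,p)`; C1 at `X` for `z`, pulled back along the surjection `σ`
  have hzH : IsOfHodgeType (2 * p) X (2 * p) p p
      (singularCohomology.ringChange (Int.castRingHom ℂ) (ComplexPoints X) (2 * p) z) :=
    isOfHodgeType_ringChange_gysinMap_complexOrientationInt hX' hX σ h2 z' hz'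
  obtain ⟨Z₁, hZ₁, hZ₁ne, y₁, hy₁⟩ :=
    genericDivisibilityBounded_divisible_map σ hsurj (hC z hzH) m hm
  -- `z' = σ^* z + κ` on `(X' ∖ (Z₁ ∪ E))(ℂ)`
  refine ⟨Z₁ ∪ E, hZ₁.union hE, genericDivisibilityBounded_union_ne_univ hZ₁ hE hZ₁ne hEne,
    singularCohomology.map ℤ ℤ Incl[X', Z₁, Z₁ ∪ E, Set.subset_union_left] (2 * p) y₁ +
      singularCohomology.map ℤ ℤ Incl[X', E, Z₁ ∪ E, Set.subset_union_right] (2 * p) y₂, ?_⟩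
  have hz'eq : z' = singularCohomology.map ℤ ℤ (AlgPoints.mapContinuous (L := ℂ) σ) (2 * p) z + κ := by
    rw [hκ, add_sub_cancel]
  have hsum : Res[X', Z₁ ∪ E, 2 * p] z' =
      Res[X', Z₁ ∪ E, 2 * p] (singularCohomology.map ℤ ℤ (AlgPoints.mapContinuous (L := ℂ) σ) (2 * p) z) +
        Res[X', Z₁ ∪ E, 2 * p] κ := by
    rw [← map_add, ← hz'eq]
  rw [nsmul_add, ← map_nsmul, ← map_nsmul, hy₁, ← hy₂,
    genericDivisibility_restrict_restrict ℤ Set.subset_union_left,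
    genericDivisibility_restrict_restrict ℤ Set.subset_union_right, hsum]

/-- **C1 is a birational invariant of smooth projective `2p`-folds (unconditional)**: for
`σ : X' ⟶ X` birational between smooth projective `2p`-folds (`p ≥ 1`), C1 holds at `X'` iff it
holds at `X` (`⇒`: `hodgeClassesGenericallyDivisible_of_isBirational`, file `…BirationalDescent`;
`⇐`: `hodgeClassesGenericallyDivisible_at_of_isBirational_up`). Compare the Hodge conjecture itself
(Voisin I, Lemma 7.28 ff.) and the companion crux C2 (`stub_cruxAtOfBirationalUp`,
`stub_cruxAtOfSurjective`). [cite: VoisinHodgeI2002, §7.3.2 Lemma 7.28 and proof of Thm. 7.31]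
[cite: Fulton1998, Lemma 19.1.2] -/
theorem hodgeClassesGenericallyDivisible_iff_of_isBirational
    (hX' : IsSmoothProjective (2 * p) X') (hX : IsSmoothProjective (2 * p) X) (σ : X' ⟶ X)
    (hσ : Literature.AlgebraicGeometry.Resolution.IsBirational σ.left) :
    C1At[p, X'] ↔ C1At[p, X] :=
  ⟨fun hC' z hz _ hm ↦ hodgeClassesGenericallyDivisible_of_isBirational hX' hX σ hσ hC' z hz hm,
    fun hC z' hz' _ hm ↦ hodgeClassesGenericallyDivisible_at_of_isBirational_up hX' hX σ hσ hC z' hz' hm⟩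

/-- **C1 passes across a roof of birational morphisms.** If `X ⟵ X'' ⟶ Y` are birational
morphisms of smooth projective `2p`-folds (`p ≥ 1`) and C1 holds at `Y`, then C1 holds at `X` (up
along `X'' ⟶ Y`, down along `X'' ⟶ X`). [cite: VoisinHodgeI2002, §7.3.2 Lemma 7.28 and proof of Thm. 7.31] -/
theorem hodgeClassesGenericallyDivisible_at_of_roof {X'' Y : SchemeOver ℂ}
    (hX'' : IsSmoothProjective (2 * p) X'') (hX : IsSmoothProjective (2 * p) X)
    (hY : IsSmoothProjective (2 * p) Y) (τ : X'' ⟶ X) (ρ : X'' ⟶ Y)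
    (hτ : Literature.AlgebraicGeometry.Resolution.IsBirational τ.left)
    (hρ : Literature.AlgebraicGeometry.Resolution.IsBirational ρ.left) (hC : C1At[p, Y]) :
    C1At[p, X] :=
  (hodgeClassesGenericallyDivisible_iff_of_isBirational hX'' hX τ hτ).1
    ((hodgeClassesGenericallyDivisible_iff_of_isBirational hX'' hY ρ hρ).2 hC)

/-- **C1 holds — for EVERY integral Hodge class — on every smooth projective `2p`-fold dominated
through a roof of birational morphisms by a product `W ⊗ ℙⁿ`, `n ≥ 1`** (e.g. a birationally ruled
`2p`-fold presented with such a roof): on `W ⊗ ℙⁿ` every integral class of degree `2p` is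
generically `m`-divisible for every `m` (`stub_hodgeClassesGenericallyDivisible_tensorProjectiveSpace`,
Hodge-blind), and C1 passes across the roof. [cite: VoisinHodgeI2002, §7.3.2 Lemma 7.28 and §11.3.3]
[cite: HatcherAT2002, Thm. 3.16 (Künneth)] -/
theorem hodgeClassesGenericallyDivisible_at_of_roof_tensorProjectiveSpace (hp : 1 ≤ p) {n : ℕ}
    (hn : 1 ≤ n) {X'' W : SchemeOver ℂ} (hX'' : IsSmoothProjective (2 * p) X'')
    (hX : IsSmoothProjective (2 * p) X) (hW : IsSmoothProjective (2 * p - n) W) (τ : X'' ⟶ X)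
    (ρ : X'' ⟶ CategoryTheory.MonoidalCategoryStruct.tensorObj W (projectiveSpace n ℂ))
    (hτ : Literature.AlgebraicGeometry.Resolution.IsBirational τ.left)
    (hρ : Literature.AlgebraicGeometry.Resolution.IsBirational ρ.left) (hnp : n ≤ 2 * p) :
    C1At[p, X] := by
  have hP : IsSmoothProjective ((2 * p - n) + n)
      (CategoryTheory.MonoidalCategoryStruct.tensorObj W (projectiveSpace n ℂ)) :=
    WeilCohomology.isSmoothProjective_tensor hW (isSmoothProjective_projectiveSpace_holds ℂ n)
  rw [Nat.sub_add_cancel hnp] at hP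
  exact hodgeClassesGenericallyDivisible_at_of_roof hX'' hX hP τ ρ hτ hρ
    fun z _ m hm ↦ stub_hodgeClassesGenericallyDivisible_tensorProjectiveSpace hp hn hW z m hm

/-! ### The registered sub-goal -/

/-- **Registered sub-goal `stub_hodgeClassesGenericallyDivisible_of_isBirational_up_unconditional`
of stmt-HodgeConjecture-18466: the crux C1 ASCENDS along birational morphisms of smooth projective
`2p`-folds, with NO hypothesis** (closed form; proof: `hodgeClassesGenericallyDivisible_at_of_isBirational_up`).
[cite: VoisinHodgeI2002, §7.3.2 Lemma 7.28 and proof of Thm. 7.31] [cite: Fulton1998, Lemma 19.1.2]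
[cite: FultonYoungTableaux1997, Appendix B §B.2 Exercise 5] -/
theorem stub_hodgeClassesGenericallyDivisible_of_isBirational_up_unconditional :
    ∀ ⦃p : ℕ⦄ ⦃X' X : SchemeOver ℂ⦄ (σ : X' ⟶ X), 1 ≤ p → IsSmoothProjective (2 * p) X' →
      IsSmoothProjective (2 * p) X → Literature.AlgebraicGeometry.Resolution.IsBirational σ.left →
      (∀ z : singularCohomology ℤ ℤ (ComplexPoints X) (2 * p),
        IsOfHodgeType (2 * p) X (2 * p) p p
            (singularCohomology.ringChange (Int.castRingHom ℂ) (ComplexPoints X) (2 * p) z) →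
          ∀ m : ℕ, 1 ≤ m → ∃ Z : Set X.left, IsClosed Z ∧ Z ≠ Set.univ ∧
            ∃ y : singularCohomology ℤ ℤ (complexPointsCompl X Z) (2 * p),
              m • y = singularCohomology.map ℤ ℤ
                (⟨Subtype.val, continuous_subtype_val⟩ :
                  C(complexPointsCompl X Z, ComplexPoints X)) (2 * p) z) →
      ∀ z' : singularCohomology ℤ ℤ (ComplexPoints X') (2 * p),
        IsOfHodgeType (2 * p) X' (2 * p) p p
            (singularCohomology.ringChange (Int.castRingHom ℂ) (ComplexPoints X') (2 * p) z') →
          ∀ m : ℕ, 1 ≤ m → ∃ Z : Set X'.left, IsClosed Z ∧ Z ≠ Set.univ ∧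
            ∃ y : singularCohomology ℤ ℤ (complexPointsCompl X' Z) (2 * p),
              m • y = singularCohomology.map ℤ ℤ
                (⟨Subtype.val, continuous_subtype_val⟩ :
                  C(complexPointsCompl X' Z, ComplexPoints X')) (2 * p) z' :=
  fun _ _ _ σ _ hX' hX hσ hC z' hz' _ hm ↦
    hodgeClassesGenericallyDivisible_at_of_isBirational_up hX' hX σ hσ hC z' hz' hm

end Summit.HodgeConjecture.HodgeConjecture.Theorems

end
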